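import Literature.AlgebraicGeometry.Resolution.MacaulayficationPrincipalization
import Literature.AlgebraicGeometry.Resolution.MacaulayficationOverCMLocus
import Literature.AlgebraicGeometry.Resolution.BlowupsExistence
import Literature.AlgebraicGeometry.Resolution.BlowupsIntegral
import Literature.AlgebraicGeometry.Resolution.BlowupsProperProofs
import Literature.AlgebraicGeometry.Resolution.BlowupsFlatBaseChange
import Literature.AlgebraicGeometry.Resolution.AlterationsNormalizationReduction
import Literature.AlgebraicGeometry.Resolution.AlterationsResolution
import Literature.AlgebraicGeometry.Resolution.QuasiProjectiveResolution
import Mathlib.AlgebraicGeometry.Noetherian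
import HarnessLib

/-!
# Česnavičius's principalization corollary FROM Macaulayfication (the derivation, proved)

Topic: `Literature/AlgebraicGeometry/Resolution`. The named fact `CesnaviciusPrincipalization`
(`MacaulayficationPrincipalization.lean`: Česnavičius 2021, §1 Cor. (principalize), special case of an
integral Cohen–Macaulay variety) is a COROLLARY of the paper's main theorem in its sharp form, the named
fact `CesnaviciusMacaulayfication` (`MacaulayficationOverCMLocus.lean`: Thm. 1.6, a Macaulayfication that is
an isomorphism over the Cohen–Macaulay locus). This file proves the implication
`cesnaviciusPrincipalization_of_cesnaviciusMacaulayfication`, following the paper's three-line argument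
(arXiv:1810.04493v2, §1, after Thm. 1.6: *"it suffices to apply Theorem 1.6 with `Bl_Z(X)` in place of
`X`"*; and the proof of Cor. (principalize): *"both `X` and `Bl_Z(X)` are CM-excellent and locally
equidimensional, the map `Bl_Z(X) → X` is an isomorphism over `U`, and the preimage of `Z` in `Bl_Z(X)` is
a divisor"*):

1. `exists_blowupPrincipalization` — blow up `Z`: `π₀ : Bl_Z X → X` is proper and birational, `Bl_Z X` is
   integral, `Z·𝒪` is an effective Cartier divisor and `π₀` is an isomorphism off `Supp Z` (the blow-up API
   of this directory: `exists_isBlowup`, `IsBlowup.isProper/isIntegral/isBirational'/isEffectiveCartier/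
   isIso_compl`);
2. Macaulayfy `Bl_Z X` by `CesnaviciusMacaulayfication`: `π₁ : W₁ → Bl_Z X` proper birational, `W₁` integral
   with Cohen–Macaulay stalks, an isomorphism over every open with Cohen–Macaulay stalks;
3. `π₁ ≫ π₀` is proper and birational (`IsBirational.comp`); the preimage of `Z` is the pull-back of an
   effective Cartier divisor along a dominant quasi-compact morphism of integral schemes, hence effective
   Cartier (`IsEffectiveCartier.comap_of_isDominant`); over `X ∖ Supp Z` the blow-up is an isomorphism, so
   the stalks of `Bl_Z X` there are those of `X`, Cohen–Macaulay (`cmClause_of_ringEquiv` along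
   `isIso_stalkMap_of_isIso_morphismRestrict`), hence `π₁` is an isomorphism over `π₀⁻¹(X ∖ Supp Z)` and the
   composite over `X ∖ Supp Z` (`morphismRestrict_comp`).

So the two Macaulayfication-type named facts of this directory used by route `FrobeniusLadder` of summit
`ResolutionOfSingularities` (`KawasakiMacaulayfication`, `CesnaviciusPrincipalization`) both follow from
`CesnaviciusMacaulayfication` (`kawasakiMacaulayfication_of_cesnaviciusMacaulayfication` in
`MacaulayficationOverCMLocus.lean`, and this file). The universe-`0` instances were first proved
summit-side (`Summit…Theorems.FRationalModification.BlowupPrincipalization`,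
`…PrincipalizationOfMacaulayfication`, crux `FRationalModification`, line `birth`).

## References

* K. Česnavičius, *Macaulayfication of Noetherian schemes*, Duke Math. J. 170 (2021) = arXiv:1810.04493v2,
  Thm. 1.6 and the Corollary (principalize) of §1; Thm. 5.3, Rem. 5.4. [Cesnavicius2021]
* The Stacks Project, Tags 02ND, 02OS (blowing up), 01WS (effective Cartier divisors). [StacksProject]
-/

noncomputable section

open CategoryTheory AlgebraicGeometry TopologicalSpace

namespace Literature.AlgebraicGeometry.Resolution

universe u

/-- The Cohen–Macaulay clause "every system of parameters (`d = dim` elements generating an ideal with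
maximal radical) is a weakly regular sequence" transports along a ring isomorphism `e : A ≃+* B`: pull the
tuple back along `e.symm`, apply the clause in `A`, push weak regularity forward
(`AddEquiv.isWeaklyRegular_congr`). [folklore] -/
theorem cmClause_of_ringEquiv {A B : Type u} [CommRing A] [CommRing B] (e : A ≃+* B)
    (hcm : ∀ d : ℕ, ringKrullDim A = d → ∀ s : Fin d → A,
      (Ideal.span (Set.range s)).radical.IsMaximal →
        RingTheory.Sequence.IsWeaklyRegular A (List.ofFn s)) :
    ∀ d : ℕ, ringKrullDim B = d → ∀ s : Fin d → B,
      (Ideal.span (Set.range s)).radical.IsMaximal →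
        RingTheory.Sequence.IsWeaklyRegular B (List.ofFn s) := by
  intro d hd s hmax
  have hdA : ringKrullDim A = d := by rw [ringKrullDim_eq_of_ringEquiv e, hd]
  have hI : Ideal.span (Set.range (e.symm ∘ s)) = (Ideal.span (Set.range s)).comap e := by
    rw [Set.range_comp, ← Ideal.map_span, Ideal.map_symm]
  have hmaxA : (Ideal.span (Set.range (e.symm ∘ s))).radical.IsMaximal := by
    rw [hI, ← Ideal.comap_radical]
    exact Ideal.comap_isMaximal_of_equiv e
  have hreg := hcm d hdA (e.symm ∘ s) hmaxA
  have hmap : List.ofFn s = (List.ofFn (e.symm ∘ s)).map e := by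
    rw [List.map_ofFn]
    congr 1
    funext i
    simp
  rw [hmap]
  refine (AddEquiv.isWeaklyRegular_congr (e := e.toAddEquiv) ?_).mp hreg
  refine List.forall₂_map_right_iff.mpr (List.forall₂_same.mpr fun r _ x => ?_)
  change e (r * x) = e r * e x
  exact map_mul e r x

/-- **Blow-up principalization** (Stacks 02ND, 02OS): for an integral locally Noetherian scheme `Y` and an
ideal sheaf `Z` whose support is not all of `Y`, the blowing up `π : Bl_Z Y → Y` is proper and birational,
`Bl_Z Y` is integral, `Z.comap π` is an effective Cartier divisor, and `π` is an isomorphism over the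
complement of `Supp Z`. [cite: StacksProject, Tags 02ND and 02OS] -/
theorem exists_blowupPrincipalization (Y : Scheme.{u}) [IsIntegral Y] [IsLocallyNoetherian Y]
    (Z : Y.IdealSheafData) (hZ : Z.support ≠ ⊤) :
    ∃ (W : Scheme.{u}) (π : W ⟶ Y), IsProper π ∧ IsBirational π ∧ IsIntegral W ∧
      IsEffectiveCartier (Z.comap π) ∧ IsIso (π ∣_ Z.support.compl) := by
  have hZ' : Z ≠ ⊥ := fun h => hZ (Scheme.IdealSheafData.support_eq_top_iff.mpr h)
  obtain ⟨W, π, hπ⟩ := exists_isBlowup Y Z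
  exact ⟨W, π, hπ.isProper, hπ.isBirational' hZ', hπ.isIntegral hZ', hπ.isEffectiveCartier,
    hπ.isIso_compl⟩

/-- **Česnavičius 2021, §1 Cor. (principalize) from Thm. 1.6** (special case of an integral Cohen–Macaulay
variety over a field): a Macaulayfication that is an isomorphism over the Cohen–Macaulay locus
(`CesnaviciusMacaulayfication`) yields Cohen–Macaulay principalization of every `Z` with `Supp Z ≠ X`
(`CesnaviciusPrincipalization`) — blow up `Z`, then Macaulayfy the blow-up; the composite is an isomorphism
over `X ∖ Supp Z` because the blow-up is one there and its stalks over it are Cohen–Macaulay.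
[cite: Cesnavicius2021, §1 Corollary (principalize) after Thm. 1.6; Thm. 5.3, Rem. 5.4] -/
theorem cesnaviciusPrincipalization_of_cesnaviciusMacaulayfication (hM : CesnaviciusMacaulayfication.{u}) :
    CesnaviciusPrincipalization.{u} := by
  intro k _ X f hs hl hq hX hCM Z hZ
  haveI := hs; haveI := hl; haveI := hq; haveI := hX
  haveI : IsLocallyNoetherian X := LocallyOfFiniteType.isLocallyNoetherian f
  -- (1) blow-up principalization of `Z`
  obtain ⟨W₀, π₀, hπ₀, hbir₀, hW₀, hcart₀, hiso₀⟩ := exists_blowupPrincipalization X Z hZ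
  haveI := hπ₀; haveI := hW₀; haveI := hiso₀
  -- (2) Macaulayfy `W₀`, by an isomorphism over its Cohen–Macaulay locus
  obtain ⟨W₁, π₁, hπ₁, hbir₁, hW₁, hCM₁, hisoU⟩ :=
    hM k W₀ (π₀ ≫ f) inferInstance inferInstance inferInstance hW₀
  haveI := hπ₁; haveI := hW₁
  haveI : IsDominant π₁ := hbir₁.isDominant
  -- (3) the composite `W₁ → W₀ → X`
  refine ⟨W₁, π₁ ≫ π₀, inferInstance, IsBirational.comp hbir₁ hbir₀, hW₁, hCM₁, ?_, ?_⟩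
  · -- the preimage of `Z` is the pull-back of an effective Cartier divisor along a dominant morphism
    rw [Scheme.IdealSheafData.comap_comp]
    exact hcart₀.comap_of_isDominant π₁
  · -- over `X ∖ Supp Z`: `π₀` is an isomorphism there, so the stalks of `W₀` over it are
    -- Cohen–Macaulay (transport along the stalk isomorphisms) and `π₁` is an isomorphism over
    -- `π₀⁻¹(X ∖ Supp Z)`; compose.
    haveI : IsIso (π₁ ∣_ π₀ ⁻¹ᵁ Z.support.compl) := by
      refine hisoU (π₀ ⁻¹ᵁ Z.support.compl) fun x hx d hd s hs => ?_
      haveI : IsIso (π₀.stalkMap x) :=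
        isIso_stalkMap_of_isIso_morphismRestrict π₀ Z.support.compl x hx
      exact cmClause_of_ringEquiv (asIso (π₀.stalkMap x)).commRingCatIsoToRingEquiv (hCM (π₀.base x))
        d hd s hs
    rw [morphismRestrict_comp]
    exact IsIso.comp_isIso (f := π₁ ∣_ π₀ ⁻¹ᵁ Z.support.compl) (h := π₀ ∣_ Z.support.compl)

end Literature.AlgebraicGeometry.Resolution

end
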